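import Summits.HubbardSuperconductivity.HubbardSuperconductivity.Theorems.AnisotropyChordTransferFibre3Dirichlet

/-!
# Route `AnisotropyChord` / H0 rotor rung: PORT N30-A revised targets — `DiscreteIMS` PROVED (`L ≥ 2`)

§285(a) of memo ROTOR-THEORY-20 (theory seat `hubbard-h0-rotor-theory-1`, cycle 20): the discrete IMS localisation
formula for the `K₁` trial state `vΠ`, `v(a,b) = 1 + e^{iK₁·a} + e^{iK₁·b}`, `Π` a real three-body product state:
`Re⟨vΠ, H₀^{K₁}(vΠ)⟩ = Re⟨|v|²Π, H₀^{0}Π⟩ + ε₁ Σ_c Π(c)[Π(a+x̂,b) + Π(a,b+x̂) + Π(a−x̂,b−x̂)]` —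
**`discreteIMS_holds (hL : 2 ≤ L) : DiscreteIMS L`**.
Proof: write both quadratic forms as diagonal part minus hopping forms (`ip_H0apply`); for each hop `c → c' = c + w`
with twist `χ` the pair `{w, −w}` satisfies the pointwise IMS identity
`2Re(v̄_c χ v_{c'}) − |v_c|² − |v_{c'}|² = −|χ v_{c'} − v_c|²` (`pt`, `pair_re`), and `|χ v_{c'} − v_c|² = |e^{iθ} − 1|² = 2ε₁`
for the six `x̂`-hops, `0` for the six `ŷ`-hops (`vfun_shift₁/₂/₃`, `normSq_phase_K1_ex`).
Prover seat `hubbard-h0-rotor-p1` g21; helper for stmt-HubbardSuperconductivity-19089 (`--supports`).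
-/

set_option linter.dupNamespace false
set_option autoImplicit false

noncomputable section

open scoped BigOperators
open Complex

namespace Summit.HubbardSuperconductivity.HubbardSuperconductivity.Theorems.AnisotropyChord.Transfer.Fibre3

variable (L : ℕ) [NeZero L]

/-- **pointwise IMS identity** for one bond with unit twist `χ`:
`Re(conj(v p)·χ v' p' + conj(v' p')·χ̄ v p) − (|v|² p p' + |v'|² p' p) = −|χv' − v|² p p'`. [folklore] -/
theorem pt (v v' χ : ℂ) (p p' : ℝ) (hχ : Complex.normSq χ = 1) :
    ((starRingEnd ℂ) (v * p) * (χ * (v' * p')) + (starRingEnd ℂ) (v' * p') * ((starRingEnd ℂ) χ * (v * p))).re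
      = ((starRingEnd ℂ) (((Complex.normSq v : ℝ) : ℂ) * p) * p'
          + (starRingEnd ℂ) (((Complex.normSq v' : ℝ) : ℂ) * p') * p).re
        - Complex.normSq (χ * v' - v) * (p * p') := by
  rw [Complex.normSq_apply] at hχ
  simp only [Complex.normSq_apply, Complex.add_re, Complex.mul_re, Complex.mul_im, Complex.sub_re, Complex.sub_im,
    Complex.conj_re, Complex.conj_im, Complex.ofReal_re, Complex.ofReal_im]
  linear_combination ((v'.re ^ 2 + v'.im ^ 2) * (p * p')) * hχ

/-- re-indexing a bond sum by the translation: `Σ_c G(c, c − w) = Σ_c G(c + w, c)`. [folklore] -/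
theorem sum_reindex_sub {α : Type*} [AddCommMonoid α] (G : Cfg L → Cfg L → α) (w : Cfg L) :
    ∑ c : Cfg L, G c (c - w) = ∑ c : Cfg L, G (c + w) c := by
  refine (Fintype.sum_equiv (Equiv.addRight w) (fun c => G (c + w) c) (fun c => G c (c - w)) fun c => ?_).symm
  simp only [Equiv.coe_addRight, add_sub_cancel_right]

/-- **pair identity:** for a hop `w` with unit twist `χ` and its reverse `−w` with twist `χ̄`,
`Re[X(w) + X(−w)] = Re[Y(w) + Y(−w)] − Σ_c |χ v(c+w) − v(c)|² P(c)P(c+w)`. [folklore] -/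
theorem pair_re (P : Cfg L → ℝ) (v : Cfg L → ℂ) (w : Cfg L) (χ : ℂ) (hχ : Complex.normSq χ = 1) :
    (∑ c : Cfg L, (starRingEnd ℂ) (v c * P c) * (χ * (v (c + w) * P (c + w)))
      + ∑ c : Cfg L, (starRingEnd ℂ) (v c * P c) * ((starRingEnd ℂ) χ * (v (c - w) * P (c - w)))).re
      = (∑ c : Cfg L, (starRingEnd ℂ) (((Complex.normSq (v c) : ℝ) : ℂ) * P c) * (P (c + w) : ℂ)
          + ∑ c : Cfg L, (starRingEnd ℂ) (((Complex.normSq (v c) : ℝ) : ℂ) * P c) * (P (c - w) : ℂ)).re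
        - ∑ c : Cfg L, Complex.normSq (χ * v (c + w) - v c) * (P c * P (c + w)) := by
  rw [sum_reindex_sub L (fun c d => (starRingEnd ℂ) (v c * P c) * ((starRingEnd ℂ) χ * (v d * P d))) w,
    sum_reindex_sub L (fun c d => (starRingEnd ℂ) (((Complex.normSq (v c) : ℝ) : ℂ) * P c) * (P d : ℂ)) w,
    ← Finset.sum_add_distrib, ← Finset.sum_add_distrib, Complex.re_sum, Complex.re_sum, ← Finset.sum_sub_distrib]
  refine Finset.sum_congr rfl fun c _ => ?_
  exact pt (v c) (v (c + w)) χ (P c) (P (c + w)) hχ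

/-- `|phase K r|² = 1`. [folklore] -/
theorem normSq_phase (K r : Tor L) : Complex.normSq (phase L K r) = 1 := by
  rw [Complex.normSq_eq_norm_sq, norm_phase]; norm_num

/-- shift of `v` under an `a`-hop: `v(c + (e,0)) − v(c) = e^{iK₁·a}(e^{iK₁·e} − 1)`. [folklore] -/
theorem vfun_shift₁ (c : Cfg L) (e : Tor L) :
    1 * vfun L (c + (e, 0)) - vfun L c = phase L (K1 L) c.1 * (phase L (K1 L) e - 1) := by
  unfold vfun; simp only [Prod.fst_add, Prod.snd_add, add_zero, phase_add]; ring

/-- shift of `v` under a `b`-hop. [folklore] -/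
theorem vfun_shift₂ (c : Cfg L) (e : Tor L) :
    1 * vfun L (c + (0, e)) - vfun L c = phase L (K1 L) c.2 * (phase L (K1 L) e - 1) := by
  unfold vfun; simp only [Prod.fst_add, Prod.snd_add, add_zero, phase_add]; ring

/-- shift of `v` under a twisted diagonal hop: `e^{iK₁·e} v(c − (e,e)) − v(c) = e^{iK₁·e} − 1`. [folklore] -/
theorem vfun_shift₃ (c : Cfg L) (e : Tor L) :
    phase L (K1 L) e * vfun L (c + (-e, -e)) - vfun L c = phase L (K1 L) e - 1 := by
  unfold vfun; simp only [Prod.fst_add, Prod.snd_add, phase_add]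
  linear_combination (phase L (K1 L) c.1 + phase L (K1 L) c.2) * phase_mul_neg L (K1 L) e

omit [NeZero L] in
/-- `|e^{iθ} − 1|² = 2ε₁` for the `x̂`-hops (`θ = 2π/L`, `L ≥ 2`). [folklore] -/
theorem normSq_phase_K1_ex [NeZero L] (hL : 2 ≤ L) : Complex.normSq (phase L (K1 L) (ex L) - 1) = 2 * eps1 L := by
  have : Fact (1 < L) := ⟨by omega⟩
  rw [phase_ex]
  unfold K1 eps1
  simp only [ZMod.val_one, Nat.cast_one]
  rw [show (2 * (Real.pi : ℂ) * Complex.I * (1 / (L : ℂ))) = ((2 * Real.pi / L : ℝ) : ℂ) * Complex.I by push_cast; ring]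
  rw [Complex.normSq_apply, Complex.sub_re, Complex.sub_im, Complex.exp_ofReal_mul_I_re, Complex.exp_ofReal_mul_I_im,
    Complex.one_re, Complex.one_im]
  nlinarith [Real.sin_sq_add_cos_sq (2 * Real.pi / L)]

/-- the same for the reverse `x̂`-hop. [folklore] -/
theorem normSq_phase_K1_neg_ex (hL : 2 ≤ L) : Complex.normSq (phase L (K1 L) (-ex L) - 1) = 2 * eps1 L := by
  rw [← conj_phase, ← normSq_phase_K1_ex L hL,
    show (starRingEnd ℂ) (phase L (K1 L) (ex L)) - 1 = (starRingEnd ℂ) (phase L (K1 L) (ex L) - 1) by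
      rw [map_sub, map_one]]
  exact Complex.normSq_conj _

/-- `e^{iK₁·(±ŷ)} = 1`. [folklore] -/
theorem phase_K1_ey : phase L (K1 L) (ey L) = 1 ∧ phase L (K1 L) (-ey L) = 1 := by
  have h : phase L (K1 L) (ey L) = 1 := by
    rw [phase_ey]; unfold K1; simp
  refine ⟨h, ?_⟩
  rw [← conj_phase, h, map_one]

/-- bond sum `Σ_c P(c) P(c + w)`. [folklore] -/
def bondSum (P : Cfg L → ℝ) (w : Cfg L) : ℝ := ∑ c : Cfg L, P c * P (c + w)

/-- the three hop types of one direction `e`, `K₁` side (trial state `vP`). [folklore] -/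
theorem hopSum_vP (P : Cfg L → ℝ) (e : Tor L) :
    hopSum L (K1 L) (fun c => vfun L c * P c) (fun c => vfun L c * P c) e
      = ∑ c : Cfg L, (starRingEnd ℂ) (vfun L c * P c) * (1 * (vfun L (c + (e, 0)) * P (c + (e, 0))))
        + ∑ c : Cfg L, (starRingEnd ℂ) (vfun L c * P c) * (1 * (vfun L (c + (0, e)) * P (c + (0, e))))
        + ∑ c : Cfg L, (starRingEnd ℂ) (vfun L c * P c)
            * (phase L (K1 L) e * (vfun L (c + (-e, -e)) * P (c + (-e, -e)))) := by
  unfold hopSum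
  have p1 : ∀ c : Cfg L, (c.1 + e, c.2) = c + (e, 0) := fun c => by ext <;> simp
  have p2 : ∀ c : Cfg L, (c.1, c.2 + e) = c + (0, e) := fun c => by ext <;> simp
  have p3 : ∀ c : Cfg L, (c.1 - e, c.2 - e) = c + (-e, -e) := fun c => by ext <;> simp [sub_eq_add_neg]
  simp_rw [p1, p2, p3, one_mul, mul_add, Finset.sum_add_distrib]

/-- the three hop types of one direction `e`, `K = 0` side (`|v|²P` against `P`). [folklore] -/
theorem hopSum_P (P : Cfg L → ℝ) (e : Tor L) :
    hopSum L 0 (fun c => ((Complex.normSq (vfun L c) : ℝ) : ℂ) * P c) (fun c => (P c : ℂ)) e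
      = ∑ c : Cfg L, (starRingEnd ℂ) (((Complex.normSq (vfun L c) : ℝ) : ℂ) * P c) * (P (c + (e, 0)) : ℂ)
        + ∑ c : Cfg L, (starRingEnd ℂ) (((Complex.normSq (vfun L c) : ℝ) : ℂ) * P c) * (P (c + (0, e)) : ℂ)
        + ∑ c : Cfg L, (starRingEnd ℂ) (((Complex.normSq (vfun L c) : ℝ) : ℂ) * P c) * (P (c + (-e, -e)) : ℂ) := by
  unfold hopSum
  have p1 : ∀ c : Cfg L, (c.1 + e, c.2) = c + (e, 0) := fun c => by ext <;> simp
  have p2 : ∀ c : Cfg L, (c.1, c.2 + e) = c + (0, e) := fun c => by ext <;> simp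
  have p3 : ∀ c : Cfg L, (c.1 - e, c.2 - e) = c + (-e, -e) := fun c => by ext <;> simp [sub_eq_add_neg]
  simp_rw [p1, p2, p3, phase_zero_left, one_mul, mul_add, Finset.sum_add_distrib]

/-- **one direction pair `{e, −e}`:** the `K₁`-side hopping forms equal the `K = 0`-side ones minus
`|e^{iK₁·e} − 1|²·(three bond sums)`, in real part. [folklore] -/
theorem hop_pair_re (P : Cfg L → ℝ) (e : Tor L) :
    (hopSum L (K1 L) (fun c => vfun L c * P c) (fun c => vfun L c * P c) e
      + hopSum L (K1 L) (fun c => vfun L c * P c) (fun c => vfun L c * P c) (-e)).re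
      = (hopSum L 0 (fun c => ((Complex.normSq (vfun L c) : ℝ) : ℂ) * P c) (fun c => (P c : ℂ)) e
          + hopSum L 0 (fun c => ((Complex.normSq (vfun L c) : ℝ) : ℂ) * P c) (fun c => (P c : ℂ)) (-e)).re
        - Complex.normSq (phase L (K1 L) e - 1)
          * (bondSum L P (e, 0) + bondSum L P (0, e) + bondSum L P (-e, -e)) := by
  rw [hopSum_vP, hopSum_vP, hopSum_P, hopSum_P]
  -- rewrite the `−e` hops as reverse translations
  have q1 : ∀ c : Cfg L, c + (-e, 0) = c - (e, 0) := fun c => by ext <;> simp [sub_eq_add_neg]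
  have q2 : ∀ c : Cfg L, c + (0, -e) = c - (0, e) := fun c => by ext <;> simp [sub_eq_add_neg]
  have q3 : ∀ c : Cfg L, c + (- -e, - -e) = c - (-e, -e) := fun c => by ext <;> simp
  simp_rw [q1, q2, q3]
  have hχ1 : Complex.normSq (1 : ℂ) = 1 := by simp
  have hχ3 : Complex.normSq (phase L (K1 L) e) = 1 := normSq_phase L (K1 L) e
  have A := pair_re L P (vfun L) (e, 0) 1 hχ1
  have B := pair_re L P (vfun L) (0, e) 1 hχ1
  have C := pair_re L P (vfun L) (-e, -e) (phase L (K1 L) e) hχ3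
  rw [map_one] at A B
  rw [← conj_phase] 
  -- the bond defects are constant multiples of the bond sums
  have nA : ∀ c : Cfg L, Complex.normSq (1 * vfun L (c + (e, 0)) - vfun L c) = Complex.normSq (phase L (K1 L) e - 1) := by
    intro c; rw [vfun_shift₁, Complex.normSq_mul, normSq_phase, one_mul]
  have nB : ∀ c : Cfg L, Complex.normSq (1 * vfun L (c + (0, e)) - vfun L c) = Complex.normSq (phase L (K1 L) e - 1) := by
    intro c; rw [vfun_shift₂, Complex.normSq_mul, normSq_phase, one_mul]
  have nC : ∀ c : Cfg L, Complex.normSq (phase L (K1 L) e * vfun L (c + (-e, -e)) - vfun L c)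
      = Complex.normSq (phase L (K1 L) e - 1) := by
    intro c; rw [vfun_shift₃]
  simp_rw [nA] at A; simp_rw [nB] at B; simp_rw [nC] at C
  rw [← Finset.mul_sum] at A B C
  unfold bondSum
  simp only [Complex.add_re] at A B C ⊢
  linarith

/-- **`DiscreteIMS` holds** (`L ≥ 2`). [folklore] -/
theorem discreteIMS_holds (hL : 2 ≤ L) : DiscreteIMS L := by
  unfold DiscreteIMS
  intro f
  set P : Cfg L → ℝ := fun c => f c.1 * f c.2 * f (c.2 - c.1) with hP
  have eF : (fun c => vfun L c * prodState L f c) = fun c => vfun L c * (P c : ℂ) := rfl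
  have eN : (fun c => ((Complex.normSq (vfun L c) : ℝ) : ℂ) * prodState L f c)
      = fun c => ((Complex.normSq (vfun L c) : ℝ) : ℂ) * (P c : ℂ) := rfl
  have eG : prodState L f = fun c => (P c : ℂ) := rfl
  rw [eF, eN, eG, ip_H0apply, ip_H0apply]
  simp only []
  -- the bond term
  have r1 : ∀ c : Cfg L, (c.1 + K1 L, c.2) = c + (ex L, 0) := fun c => Prod.ext rfl (by simp)
  have r2 : ∀ c : Cfg L, (c.1, c.2 + K1 L) = c + (0, ex L) := fun c => Prod.ext (by simp) rfl
  have r3 : ∀ c : Cfg L, (c.1 - K1 L, c.2 - K1 L) = c + (-ex L, -ex L) := fun c =>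
    Prod.ext (by simp [sub_eq_add_neg]; rfl) (by simp [sub_eq_add_neg]; rfl)
  have hB : (∑ c : Cfg L, (P c : ℂ) * ((P (c.1 + K1 L, c.2) : ℂ) + (P (c.1, c.2 + K1 L) : ℂ)
      + (P (c.1 - K1 L, c.2 - K1 L) : ℂ))).re
      = bondSum L P (ex L, 0) + bondSum L P (0, ex L) + bondSum L P (-ex L, -ex L) := by
    simp_rw [r1, r2, r3]
    unfold bondSum
    rw [← Finset.sum_add_distrib, ← Finset.sum_add_distrib, Complex.re_sum]
    refine Finset.sum_congr rfl fun c _ => ?_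
    simp only [← Complex.ofReal_mul, ← Complex.ofReal_add, Complex.ofReal_re]; ring
  rw [hB]
  -- diagonal parts agree
  have hdiag : ip L (fun c => vfun L c * (P c : ℂ)) (fun c => vfun L c * (P c : ℂ))
      = ip L (fun c => ((Complex.normSq (vfun L c) : ℝ) : ℂ) * (P c : ℂ)) (fun c => (P c : ℂ)) := by
    unfold ip; refine Finset.sum_congr rfl fun c _ => ?_
    simp only [map_mul, Complex.conj_ofReal, Complex.normSq_eq_conj_mul_self, Complex.conj_conj]; ring
  rw [hdiag]
  -- the two direction pairs
  have hx := hop_pair_re L P (ex L)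
  have hy := hop_pair_re L P (ey L)
  rw [normSq_phase_K1_ex L hL] at hx
  rw [(phase_K1_ey L).1, sub_self, map_zero, zero_mul, sub_zero] at hy
  simp only [Complex.sub_re, Complex.add_re, Complex.mul_re] at hx hy ⊢
  norm_num at hx hy ⊢
  linarith

end Summit.HubbardSuperconductivity.HubbardSuperconductivity.Theorems.AnisotropyChord.Transfer.Fibre3

end
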